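import Literature.NumberTheory.EllipticCurves.Kato2004.IwasawaH1ReductionTowerConj
import Literature.NumberTheory.EllipticCurves.IwasawaTwistModPDual
import Literature.NumberTheory.EllipticCurves.IwasawaSelmerControlCokerProofs
import Literature.NumberTheory.EllipticCurves.GreenbergSelmerDualDataExistsProofs
import Literature.NumberTheory.EllipticCurves.SelmerProofs
import Literature.NumberTheory.EllipticCurves.GeomPointsGaloisModule
import HarnessLib

/-!
# K6 crux `MuTransferX9` (stmt-BirchSwinnertonDyer-19276), stub `stub_selmerDualOdd` (skeleton v6), part 1:
# from a class of `H¹(K_∞, E[p])` to a class of `H¹(K, 𝒯_{p^n}(E, κ⁻¹))` with the same `T`-order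
# (layer descent + Shapiro for the dual twist; `T = conj_γ − 1 ↔ S` exactly)

Cell `bsd-smallim`, seat `bsd-smallim-k6-c2` (gen 3). HONEST FRAMING: theorems only (no definition, no named
fact, no `sorry`); nothing is asserted about any curve and nothing is booked. First file toward the
registered stub `stub_selmerDualOdd` of skeleton v6 (sha16 a90a661b046bb403) of crux 19276 = MU-TRANSFER-PROOF
§5 STEP 1, Selmer side ("`y ↦ c'`, a class of `H¹(G_S, 𝒯_J^*)` of exact order `J`").  For an elliptic curve
`E = W` over a number field `K`, a prime `p`, a `ℤ_p`-extension `κ` with topological generator `γ`: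

* `resOfLe_iterate_conj_sub` — restriction commutes with `(conj_γ − id)^[J]` (tree `resOfLe_comp_conjH1`).
* `exists_layer_resOfLe_eq` — every `y ∈ H¹(K_∞, E[p])` (`subgroupH1 κ.kerSubgroup E[p]`) is the
  restriction of a class `y_n ∈ H¹(K_n, E[p])` of some layer (and then of every higher layer,
  `exists_layer_resOfLe_eq_of_le`): the tree's `GreenbergSelmer.exists_conjH1_pow_prime_pow_eq` (open
  stabilisers ⟹ `conj_{γ^{p^a}} y = y`) and `ZpExtension.mem_range_resOfLe_of_conjH1_eq` (Greenberg's
  Lemma 3.2 / `cd ℤ_p = 1`, PROVED in `IwasawaSelmerControlCokerProofs`).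
* `coresShapiro_invTwist_conj_sub` — **`Sh⁻¹((conj_γ − 1) c) = T · Sh⁻¹(c)`** for the DUAL twist
  `𝒯_{p^n}(κ⁻¹)`: with k6-ty's `coresShapiro_conjMap` (`conj_g ↔ (1+S)^{−κ̄⁻¹(g)}`) at `g = γ`,
  `−κ̄⁻¹(γ) = 1`, so `conj_γ ↔ 1 + S` and `conj_γ − 1 ↔ S` ON THE NOSE (no unit; `unipotentH1_succ`);
  iterated form `coresShapiro_invTwist_iterate_conj_sub`.
* `exists_invTwist_class_of_iterate_ne_zero` — the assembly: for `y ∈ H¹(K_∞, E[p])` with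
  `(conj_γ − id)^[J] y ≠ 0` there are `n` and `Y ∈ H¹(K, 𝒯_{p^n}(E, κ⁻¹))` with `T^[J] Y ≠ 0` whose Shapiro
  image restricts to `y` (transport `κ.kerSubgroup = κ⁻¹.kerSubgroup` by `resOfLe` along the equality).

What is NOT here (next files of the stub): the level reduction `H¹(K, 𝒯_{p^n}) ⊃ T`-torsion `↔ H¹(K, 𝒯_{J+1})`
(`shiftEmbedH1`), and the local conditions of `Ψ` (unramified off `S`, `T^ε` on `S`).

PARTITION (D-0054): X9 (A4) × p ∈ {5,7} (and X10b∧¬Surj at p = 3) — helper toward `stub_selmerDualOdd`;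
closes none.

References: HOME/koly/MU-TRANSFER-PROOF.md §5 STEP 1; R. Greenberg, LNM 1716 (1999) §3 Lemma 3.2
[GreenbergLNM1716]; J.-P. Serre, *Galois Cohomology* I §2.5 [SerreGaloisCohomology1997]; L. Washington,
*Introduction to Cyclotomic Fields* §13.1–13.2 [Washington1997].
-/

set_option linter.dupNamespace false
set_option autoImplicit false

noncomputable section

open scoped NumberField
open Field
open WeierstrassCurve (geomTorsion)
open Literature.NumberTheory.GaloisRepresentations
open Literature.NumberTheory.EllipticCurves

universe u

namespace Summit.BirchSwinnertonDyer.BirchSwinnertonDyer.Rank1Residual.SelmerDual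

/-! ## Restriction and conjugation commute with `(conj_γ − id)^[J]` -/

section Generic

variable {G : Type u} [Group G] [TopologicalSpace G] [IsTopologicalGroup G]
  {M : Type u} [AddCommGroup M] [DistribMulAction G M] [TopologicalSpace M] [DiscreteTopology M]

/-- An additive map commuting with `conj_γ` on both sides commutes with the iterates of `conj_γ − id`.
[cite: NeukirchSchmidtWingberg2008, I.§5] -/
theorem map_iterate_sub_id {A B : Type*} [AddCommGroup A] [AddCommGroup B] (f : A →+ B) (u : A →+ A)
    (v : B →+ B) (hf : ∀ a, f (u a) = v (f a)) (J : ℕ) (a : A) :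
    f ((⇑(u - AddMonoidHom.id A))^[J] a) = (⇑(v - AddMonoidHom.id B))^[J] (f a) := by
  induction J generalizing a with
  | zero => rfl
  | succ J ih =>
    rw [Function.iterate_succ_apply', Function.iterate_succ_apply', ← ih, AddMonoidHom.sub_apply,
      AddMonoidHom.sub_apply, map_sub, hf, AddMonoidHom.id_apply, AddMonoidHom.id_apply]

/-- Restriction commutes with the iterates of `conj_γ − id`: for normal subgroups `H ≤ H'` of `G`,
`res ((conj_γ − id)^[J] x) = (conj_γ − id)^[J] (res x)`. [cite: NeukirchSchmidtWingberg2008, I.§5] -/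
theorem resOfLe_iterate_conj_sub {H H' : Subgroup G} [H.Normal] [H'.Normal] (h : H ≤ H') (γ : G) (J : ℕ)
    (x : subgroupH1 H' M) :
    resOfLe M h ((⇑(conjH1 H' M γ - AddMonoidHom.id (subgroupH1 H' M)))^[J] x) =
      (⇑(conjH1 H M γ - AddMonoidHom.id (subgroupH1 H M)))^[J] (resOfLe M h x) :=
  map_iterate_sub_id (resOfLe M h) (conjH1 H' M γ) (conjH1 H M γ)
    (fun a => DFunLike.congr_fun (resOfLe_comp_conjH1_holds (M := M) h γ) a) J x

end Generic

/-! ## Every class of `H¹(K_∞, E[p])` comes from a finite layer -/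

section Layer

variable {K : Type u} [Field K] [NumberField K] (W : WeierstrassCurve K) (p : ℕ) [Fact p.Prime]
  (κ : ZpExtension K p)

/-- **`H¹(K_∞, E[p]) = ⋃_n res H¹(K_n, E[p])`**: every class `y` of `H¹(K_∞, E[p])` is the restriction of a
class of some finite layer `K_n` of the `ℤ_p`-extension.  (`y` is fixed by `conj_{γ^{p^n}}` for some `n`
since the points of `E[p]` have open stabilisers, and Greenberg's Lemma 3.2 — `cd ℤ_p = 1`, PROVED in the
tree — lifts `γ^{p^n}`-invariant classes to `K_n`.) [cite: GreenbergLNM1716, §3 Lemma 3.2]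
[cite: SerreGaloisCohomology1997, I §2.2 Prop. 8] -/
theorem exists_layer_resOfLe_eq {γ : absoluteGaloisGroup K} (hγ : κ.IsTopGenerator γ)
    (y : subgroupH1 κ.kerSubgroup (geomTorsion W (p : ℤ))) :
    ∃ (n : ℕ) (yn : subgroupH1 (κ.layerSubgroup n) (geomTorsion W (p : ℤ))),
      resOfLe (geomTorsion W (p : ℤ)) (κ.kerSubgroup_le_layerSubgroup n) yn = y := by
  have hstab : ∀ m : geomTorsion W (p : ℤ),
      IsOpen ((MulAction.stabilizer (absoluteGaloisGroup K) m : Subgroup _) : Set (absoluteGaloisGroup K)) :=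
    fun m => W.isOpen_stabilizer_geomTorsion (p : ℤ) m
  obtain ⟨a, ha⟩ := GreenbergSelmer.exists_conjH1_pow_prime_pow_eq κ (geomTorsion W (p : ℤ)) hstab hγ y
  have hcont : ∀ m : geomTorsion W (p : ℤ), Continuous fun g : absoluteGaloisGroup K => g • m :=
    fun m => continuous_smul_of_isOpen_stabilizer m (hstab m)
  have hprim : ∀ m : geomTorsion W (p : ℤ), ∃ k : ℕ, p ^ k • m = 0 :=
    fun m => ⟨1, by rw [pow_one]; exact AddSubgroup.torsionBy.nsmul m⟩
  obtain ⟨yn, hyn⟩ := κ.mem_range_resOfLe_of_conjH1_eq hγ a hcont hprim y ha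
  exact ⟨a, yn, hyn⟩

/-- The same from every higher layer `n' ≥ n` (restrict `y_n` to `K_{n'}` first).
[cite: GreenbergLNM1716, §3 Lemma 3.2] -/
theorem exists_layer_resOfLe_eq_of_le {γ : absoluteGaloisGroup K} (hγ : κ.IsTopGenerator γ)
    (y : subgroupH1 κ.kerSubgroup (geomTorsion W (p : ℤ))) :
    ∃ n₀ : ℕ, ∀ n : ℕ, n₀ ≤ n → ∃ yn : subgroupH1 (κ.layerSubgroup n) (geomTorsion W (p : ℤ)),
      resOfLe (geomTorsion W (p : ℤ)) (κ.kerSubgroup_le_layerSubgroup n) yn = y := by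
  obtain ⟨n₀, y₀, hy₀⟩ := exists_layer_resOfLe_eq W p κ hγ y
  refine ⟨n₀, fun n hn => ⟨resOfLe (geomTorsion W (p : ℤ)) (κ.layerSubgroup_antitone hn) y₀, ?_⟩⟩
  rw [← hy₀]
  exact DFunLike.congr_fun (resOfLe_comp_holds (M := geomTorsion W (p : ℤ))
    (κ.kerSubgroup_le_layerSubgroup n) (κ.layerSubgroup_antitone hn)) y₀

end Layer

/-! ## Shapiro for the dual twist: `conj_γ − 1 ↔ T` exactly -/

section Shapiro

variable {K : Type u} [Field K] {p : ℕ} [Fact p.Prime] (κ : ZpExtension K p) (n : ℕ)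

/-- `κ̄⁻¹_n(g) = −κ̄_n(g)`. [cite: Washington1997, §13.1–§13.2] -/
theorem layerIndex_invTwist (g : absoluteGaloisGroup K) :
    κ.invTwist.layerIndex n g = -κ.layerIndex n g := by
  rw [ZpExtension.layerIndex, ZpExtension.layerIndex, ZpExtension.toAdd_invTwist_apply, map_neg]

variable (W : WeierstrassCurve K)

/-- **`Sh⁻¹(conj_γ c) = (1 + T)·Sh⁻¹(c)` for the dual twist `𝒯_{p^n}(E, κ⁻¹)`** and a topological
generator `γ` of `κ` (`conjH1` on `H¹(K_n, E[p])`): k6-ty's dictionary `coresShapiro_conjMap`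
(`conj_g ↔ (1+S)^{−κ̄⁻¹_n(g)}`) at `g = γ`, where `−κ̄⁻¹_n(γ) = κ̄_n(γ) = 1`, and `unipotentH1_succ`.
[cite: SerreGaloisCohomology1997, I §2.5 (b)] [cite: Washington1997, §13.1–§13.2] -/
theorem coresShapiro_invTwist_conjH1 [Fintype (absoluteGaloisGroup K ⧸ κ.invTwist.layerSubgroup n)]
    {γ : absoluteGaloisGroup K} (hγ : κ.IsTopGenerator γ)
    (c : subgroupH1 (κ.invTwist.layerSubgroup n) (geomTorsion W (p : ℤ))) :
    κ.invTwist.coresShapiro (W.torsionGaloisModule (p : ℤ))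
        (fun P : geomTorsion W (p : ℤ) => AddSubgroup.torsionBy.nsmul P) n
        (conjH1 (κ.invTwist.layerSubgroup n) (geomTorsion W (p : ℤ)) γ c) =
      κ.invTwist.coresShapiro (W.torsionGaloisModule (p : ℤ))
          (fun P : geomTorsion W (p : ℤ) => AddSubgroup.torsionBy.nsmul P) n c +
        κ.invTwist.shiftH1 (W.torsionGaloisModule (p : ℤ))
          (fun P : geomTorsion W (p : ℤ) => AddSubgroup.torsionBy.nsmul P) (p ^ n)
          (κ.invTwist.coresShapiro (W.torsionGaloisModule (p : ℤ))
            (fun P : geomTorsion W (p : ℤ) => AddSubgroup.torsionBy.nsmul P) n c) := by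
  have ha : ((1 : ℕ) : ZMod (p ^ n)) = -κ.invTwist.layerIndex n γ := by
    rw [layerIndex_invTwist, neg_neg, κ.layerIndex_eq_one_of_isTopGenerator n hγ, Nat.cast_one]
  have h := κ.invTwist.coresShapiro_conjMap (W.torsionGaloisModule (p : ℤ))
    (fun P : geomTorsion W (p : ℤ) => AddSubgroup.torsionBy.nsmul P) n γ ha c
  rw [κ.invTwist.unipotentH1_succ, κ.invTwist.unipotentH1_zero] at h
  exact h

/-- Hence **`Sh⁻¹((conj_γ − id)^[J] c) = T^[J] Sh⁻¹(c)`** — `T = conj_γ − 1` IS the shift on the dual twist.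
[cite: SerreGaloisCohomology1997, I §2.5 (b)] [cite: Washington1997, §13.1–§13.2] -/
theorem coresShapiro_invTwist_iterate_conj_sub
    [Fintype (absoluteGaloisGroup K ⧸ κ.invTwist.layerSubgroup n)]
    {γ : absoluteGaloisGroup K} (hγ : κ.IsTopGenerator γ) (J : ℕ)
    (c : subgroupH1 (κ.invTwist.layerSubgroup n) (geomTorsion W (p : ℤ))) :
    κ.invTwist.coresShapiro (W.torsionGaloisModule (p : ℤ))
        (fun P : geomTorsion W (p : ℤ) => AddSubgroup.torsionBy.nsmul P) n
        ((⇑(conjH1 (κ.invTwist.layerSubgroup n) (geomTorsion W (p : ℤ)) γ -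
          AddMonoidHom.id (subgroupH1 (κ.invTwist.layerSubgroup n) (geomTorsion W (p : ℤ)))))^[J] c) =
      (κ.invTwist.shiftH1 (W.torsionGaloisModule (p : ℤ))
          (fun P : geomTorsion W (p : ℤ) => AddSubgroup.torsionBy.nsmul P) (p ^ n))^[J]
        (κ.invTwist.coresShapiro (W.torsionGaloisModule (p : ℤ))
          (fun P : geomTorsion W (p : ℤ) => AddSubgroup.torsionBy.nsmul P) n c) := by
  have key := map_iterate_sub_id
    (κ.invTwist.coresShapiro (W.torsionGaloisModule (p : ℤ))
      (fun P : geomTorsion W (p : ℤ) => AddSubgroup.torsionBy.nsmul P) n :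
      subgroupH1 (κ.invTwist.layerSubgroup n) (geomTorsion W (p : ℤ)) →+ _)
    (conjH1 (κ.invTwist.layerSubgroup n) (geomTorsion W (p : ℤ)) γ)
    (κ.invTwist.shiftH1 (W.torsionGaloisModule (p : ℤ))
        (fun P : geomTorsion W (p : ℤ) => AddSubgroup.torsionBy.nsmul P) (p ^ n) +
      AddMonoidHom.id _)
    (fun a => by
      rw [AddMonoidHom.add_apply, AddMonoidHom.id_apply, add_comm]
      exact coresShapiro_invTwist_conjH1 κ n W hγ a) J c
  rw [add_sub_cancel_right] at key
  exact key

end Shapiro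

/-! ## Assembly: a class of the dual twist with the same `T`-order -/

section Assembly

variable {K : Type u} [Field K] [NumberField K] (W : WeierstrassCurve K) (p : ℕ) [Fact p.Prime]
  (κ : ZpExtension K p)

/-- **From `y ∈ H¹(K_∞, E[p])` with `(conj_γ − id)^J y ≠ 0` to a class `Y ∈ H¹(K, 𝒯_{p^n}(E, κ⁻¹))` with
`T^J Y ≠ 0`** (MU-TRANSFER-PROOF §5 STEP 1, Selmer side, first half), for every large `n`: `Y = Sh⁻¹(y_n)`
for a layer class `y_n` restricting to `y`; recorded with the relation `Sh⁻¹(y_n) = Y` and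
`res y_n = y` (transported along `κ⁻¹.kerSubgroup = κ.kerSubgroup`) for the later local analysis.
[cite: GreenbergLNM1716, §3 Lemma 3.2] [cite: SerreGaloisCohomology1997, I §2.5 Prop. 10] -/
theorem exists_invTwist_class_of_iterate_ne_zero {γ : absoluteGaloisGroup K} (hγ : κ.IsTopGenerator γ)
    (J : ℕ) (y : subgroupH1 κ.kerSubgroup (geomTorsion W (p : ℤ)))
    (hy : (⇑(conjH1 κ.kerSubgroup (geomTorsion W (p : ℤ)) γ -
      AddMonoidHom.id (subgroupH1 κ.kerSubgroup (geomTorsion W (p : ℤ)))))^[J] y ≠ 0) :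
    ∃ n₀ : ℕ, ∀ n : ℕ, n₀ ≤ n →
      ∃ (yn : subgroupH1 (κ.invTwist.layerSubgroup n) (geomTorsion W (p : ℤ)))
        (Y : galoisCohomology (κ.invTwist.twistModP (W.torsionGaloisModule (p : ℤ))
          (fun P : geomTorsion W (p : ℤ) => AddSubgroup.torsionBy.nsmul P) (p ^ n)) 1),
        resOfLe (geomTorsion W (p : ℤ)) (κ.invTwist.kerSubgroup_le_layerSubgroup n) yn =
          resOfLe (geomTorsion W (p : ℤ)) (κ.kerSubgroup_unitTwist (-1)).le y ∧
        κ.invTwist.twistModPH1Equiv (W.torsionGaloisModule (p : ℤ))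
          (fun P : geomTorsion W (p : ℤ) => AddSubgroup.torsionBy.nsmul P) n Y = yn ∧
        (κ.invTwist.shiftH1 (W.torsionGaloisModule (p : ℤ))
          (fun P : geomTorsion W (p : ℤ) => AddSubgroup.torsionBy.nsmul P) (p ^ n))^[J] Y ≠ 0 := by
  -- transport `y` to `κ⁻¹.kerSubgroup (= κ.kerSubgroup)`
  set y' : subgroupH1 κ.invTwist.kerSubgroup (geomTorsion W (p : ℤ)) :=
    resOfLe (geomTorsion W (p : ℤ)) (κ.kerSubgroup_unitTwist (-1)).le y with hy'def
  have hback : resOfLe (geomTorsion W (p : ℤ)) (κ.kerSubgroup_unitTwist (-1)).ge y' = y := by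
    rw [hy'def, ← AddMonoidHom.comp_apply,
      resOfLe_comp_holds (M := geomTorsion W (p : ℤ)) (κ.kerSubgroup_unitTwist (-1)).ge
        (κ.kerSubgroup_unitTwist (-1)).le]
    exact DFunLike.congr_fun (resOfLe_refl_holds (M := geomTorsion W (p : ℤ)) κ.kerSubgroup) y
  have hy' : (⇑(conjH1 κ.invTwist.kerSubgroup (geomTorsion W (p : ℤ)) γ -
      AddMonoidHom.id (subgroupH1 κ.invTwist.kerSubgroup (geomTorsion W (p : ℤ)))))^[J] y' ≠ 0 := by
    intro h0
    apply hy
    rw [← hback, ← resOfLe_iterate_conj_sub, h0, map_zero]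
  -- a layer class for `κ⁻¹` (its topological generator `γ⁻¹` only feeds the layer lemma)
  have hγ' : κ.invTwist.IsTopGenerator γ⁻¹ := by
    unfold ZpExtension.IsTopGenerator at hγ ⊢
    apply Multiplicative.toAdd.injective
    rw [ZpExtension.toAdd_invTwist_apply, map_inv, toAdd_inv, neg_neg, hγ]
  obtain ⟨n₀, hn₀⟩ := exists_layer_resOfLe_eq_of_le W p κ.invTwist hγ' y'
  refine ⟨n₀, fun n hn => ?_⟩
  obtain ⟨yn, hyn⟩ := hn₀ n hn
  haveI : CompactSpace (absoluteGaloisGroup K) := absoluteGaloisGroup_compactSpace K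
  letI : Fintype (absoluteGaloisGroup K ⧸ κ.invTwist.layerSubgroup n) := κ.invTwist.fintypeQuotientLayer n
  refine ⟨yn, κ.invTwist.coresShapiro (W.torsionGaloisModule (p : ℤ)) _ n yn, hyn,
    κ.invTwist.twistModPH1Equiv_coresShapiro (W.torsionGaloisModule (p : ℤ)) _ n yn, ?_⟩
  -- `T`-order: `T^[J] Sh⁻¹(y_n) = Sh⁻¹((conj_γ − id)^[J] y_n) ≠ 0`
  have hres : (⇑(conjH1 (κ.invTwist.layerSubgroup n) (geomTorsion W (p : ℤ)) γ -
      AddMonoidHom.id (subgroupH1 (κ.invTwist.layerSubgroup n) (geomTorsion W (p : ℤ)))))^[J] yn ≠ 0 := by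
    intro h0
    apply hy'
    rw [← hyn, ← resOfLe_iterate_conj_sub, h0, map_zero]
  intro h0
  apply hres
  have h1 := (coresShapiro_invTwist_iterate_conj_sub κ n W hγ J yn).trans h0
  exact (κ.invTwist.coresShapiro_eq_zero_iff (W.torsionGaloisModule (p : ℤ)) _ n _).1 h1

end Assembly

end Summit.BirchSwinnertonDyer.BirchSwinnertonDyer.Rank1Residual.SelmerDual

end
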